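import Summits.PneNP.PneNP.Theorems.ConvexRankGatesConvexGateBlindStubPerfectCompletenessFourier

/-!
# Grigoriev's perfect-completeness functional for an abstract XOR (Tseitin) instance
(helper for stub `stub_perfectCompleteness` of line `xor-door-perfect-completeness`, crux `ConvexGateBlind`,
item stmt-PneNP-10680; registered sub-goal `stub_perfectCompleteness_functional`)

For an XOR instance with variable sets `A : V → Finset (Fin m)` and right-hand sides `c : V → ZMod 2`
(equation `v`: `∑_{x ∈ A v} y x = c v`), a scale `K` and a degree `d`, Grigoriev's functional
(Grigoriev, *Theoret. Comput. Sci.* 259 (2001) 613–622, §2; Schoenebeck, FOCS 2008, Thm 1) is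
`Ẽ f = ∑_S f̂(S) e(S)` with the pseudo-character `e(S) = (-1)^{charge T}` when `S = ∂T` for a set `T`
of at most `K` equations ("`S` determined") and `e(S) = 0` otherwise.

Under the ISOPERIMETRIC HYPOTHESES `IsoHyp A K d` (`3K < #V`, `1 ≤ K`, a set of equations whose
boundary has `≤ d` variables is small or co-small, only `∅`/`univ` have empty boundary) we prove:
`e` is well defined (`IsoHyp.e_eq`), multiplicative under small symmetric differences
(`IsoHyp.e_mul`), and the functional `func A c K` satisfies

* `Ẽ 1 = 1` (`IsoHyp.func_one`);
* `Ẽ [equation v violated] = 0` for every `v` (`IsoHyp.func_violInd`) — perfect completeness;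
* `Ẽ f ≥ 0` for every non-negative `d`-junta `f` (`IsoHyp.func_nonneg_of_junta`, Sherali–Adams
  positivity, via the character-sum lemma `sum_nonneg_of_symmDiff_closed`).

Sum-of-squares positivity is in the sequel file `…StubPerfectCompletenessSos`. No graph appears here:
the honeycomb torus supplying `IsoHyp` is in `…StubPerfectCompletenessHoneycomb{,Iso}`.
-/

set_option linter.dupNamespace false -- `Summit.PneNP.PneNP.…`: summit = sub-problem (D-0017)

namespace Summit.PneNP.PneNP.Theorems.XorDoor.PC

open Finset

noncomputable section

variable {m : ℕ} {V : Type*}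

/-! ### Determined sets and the pseudo-character `e` -/

/-- `S` is *determined* (at scale `K`): it is the boundary of a set of at most `K` equations.
[folklore] -/
def Det (A : V → Finset (Fin m)) (K : ℕ) (S : Finset (Fin m)) : Prop :=
  ∃ T : Finset V, T.card ≤ K ∧ bd A T = S

open scoped Classical in
/-- Grigoriev's pseudo-character: `e(S) = (-1)^{charge T}` if `S = ∂T` with `#T ≤ K`, and `0` if
`S` is not determined. [folklore] -/
def e (A : V → Finset (Fin m)) (c : V → ZMod 2) (K : ℕ) (S : Finset (Fin m)) : ℝ :=
  if ∃ T : Finset V, T.card ≤ K ∧ bd A T = S ∧ charge c T = 1 then -1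
  else if Det A K S then 1 else 0

/-- `e` vanishes on undetermined sets. [folklore] -/
theorem e_eq_zero {A : V → Finset (Fin m)} {c : V → ZMod 2} {K : ℕ} {S : Finset (Fin m)}
    (hS : ¬ Det A K S) : e A c K S = 0 := by
  unfold e
  have h1 : ¬ ∃ T : Finset V, T.card ≤ K ∧ bd A T = S ∧ charge c T = 1 :=
    fun ⟨T, hT, hS', _⟩ => hS ⟨T, hT, hS'⟩
  rw [if_neg h1, if_neg hS]

/-- `∅` is determined. [folklore] -/
theorem det_empty (A : V → Finset (Fin m)) (K : ℕ) : Det A K ∅ := ⟨∅, by simp, bd_empty A⟩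

/-! ### The functional -/

/-- Grigoriev's functional `Ẽ f = ∑_S f̂(S) e(S)`, a linear form on real functions of `𝔽₂^m`.
[folklore] -/
def func (A : V → Finset (Fin m)) (c : V → ZMod 2) (K : ℕ) : ((Fin m → ZMod 2) → ℝ) →ₗ[ℝ] ℝ :=
  ∑ S : Finset (Fin m), e A c K S • coeffLin S

/-- `Ẽ f = ∑_S e(S) f̂(S)`. [folklore] -/
theorem func_apply (A : V → Finset (Fin m)) (c : V → ZMod 2) (K : ℕ)
    (f : (Fin m → ZMod 2) → ℝ) : func A c K f = ∑ S, e A c K S * coeff f S := by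
  simp [func, LinearMap.sum_apply, LinearMap.smul_apply]

/-- `Ẽ χ_T = e(T)`. [folklore] -/
theorem func_chi (A : V → Finset (Fin m)) (c : V → ZMod 2) (K : ℕ) (T : Finset (Fin m)) :
    func A c K (chi T) = e A c K T := by
  rw [func_apply]
  simp_rw [coeff_chi, mul_ite, mul_one, mul_zero]
  rw [Finset.sum_ite_eq' univ T]
  simp

/-- `Ẽ (s²) = ∑_{S, S'} ŝ(S) ŝ(S') e(S ∆ S')`. [folklore] -/
theorem func_mul_self (A : V → Finset (Fin m)) (c : V → ZMod 2) (K : ℕ)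
    (s : (Fin m → ZMod 2) → ℝ) :
    func A c K (s * s) = ∑ S, ∑ S', coeff s S * coeff s S' * e A c K (symmDiff S S') := by
  have hprod : s * s = ∑ S, ∑ S', (coeff s S * coeff s S') • chi (symmDiff S S') := by
    conv_lhs => rw [eq_sum_coeff_smul_chi s]
    rw [sum_mul_sum]
    refine sum_congr rfl fun S _ => sum_congr rfl fun S' _ => ?_
    funext y
    simp only [Pi.mul_apply, Pi.smul_apply, smul_eq_mul, ← chi_mul_chi]
    ring
  rw [hprod, map_sum]
  refine sum_congr rfl fun S _ => ?_
  rw [map_sum]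
  refine sum_congr rfl fun S' _ => ?_
  rw [map_smul, func_chi, smul_eq_mul]

/-- The violation indicator of the equation `v` (`χ_{A v}(y) = sgn (c v)`, i.e. `∑_{x ∈ A v} y x = c v`)
is `(1 - sgn(c v) χ_{A v}(y)) / 2`. [folklore] -/
theorem violInd_eq (A : V → Finset (Fin m)) (c : V → ZMod 2) (v : V) (y : Fin m → ZMod 2) :
    (if chi (A v) y = sgn (c v) then (0 : ℝ) else 1) = (1 - sgn (c v) * chi (A v) y) / 2 := by
  rcases chi_eq_one_or (A v) y with h1 | h1 <;> rcases sgn_eq_one_or (c v) with h2 | h2 <;>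
    norm_num [h1, h2]

/-- **Character-sum lemma.** A `±1`-valued multiplicative function on a `∆`-closed family of sets
has non-negative sum (the sum is `#G` or, pairing `S ↔ S ∆ S₁` with `ψ S₁ = -1`, zero). [folklore] -/
theorem sum_nonneg_of_symmDiff_closed {α : Type*} [DecidableEq α] (G : Finset (Finset α))
    (ψ : Finset α → ℝ) (hcl : ∀ S ∈ G, ∀ S' ∈ G, symmDiff S S' ∈ G)
    (hmul : ∀ S ∈ G, ∀ S' ∈ G, ψ (symmDiff S S') = ψ S * ψ S')
    (hval : ∀ S ∈ G, ψ S = 1 ∨ ψ S = -1) : 0 ≤ ∑ S ∈ G, ψ S := by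
  by_cases hall : ∀ S ∈ G, ψ S = 1
  · exact sum_nonneg fun S hS => by rw [hall S hS]; exact zero_le_one
  push Not at hall
  obtain ⟨S₁, hS₁, hne⟩ := hall
  have hψ₁ : ψ S₁ = -1 := (hval S₁ hS₁).resolve_left hne
  have hS₁ne : S₁ ≠ ∅ := by
    rintro rfl
    have h1 := hmul ∅ hS₁ ∅ hS₁
    rw [symmDiff_self, Finset.bot_eq_empty, hψ₁] at h1
    norm_num at h1
  have hsum : ∑ S ∈ G, ψ S = 0 := by
    refine Finset.sum_involution (fun S _ => symmDiff S S₁) ?_ ?_ ?_ ?_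
    · intro S hS
      rw [hmul S hS S₁ hS₁, hψ₁]
      ring
    · intro S _ _
      rw [Ne, symmDiff_eq_left, Finset.bot_eq_empty]
      exact hS₁ne
    · intro S hS
      exact hcl S hS S₁ hS₁
    · intro S _
      exact symmDiff_symmDiff_cancel_right _ _
  rw [hsum]

/-! ### Isoperimetric hypotheses and the four properties -/

variable [Fintype V] [DecidableEq V]

/-- The isoperimetric hypotheses on an XOR instance with variable sets `A : V → Finset (Fin m)`, at
scale `K` (a set of equations is *small* if it has at most `K` elements) and degree `d`:
`3K < #V`, `1 ≤ K`, every set of equations whose boundary has at most `d` variables is small or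
co-small, and only `∅` and `univ` have empty boundary (Grigoriev 2001 asks this of Tseitin
instances on expanders; here it is an abstract interface). [folklore] -/
structure IsoHyp (A : V → Finset (Fin m)) (K d : ℕ) : Prop where
  /-- three small sets never cover all equations -/
  three_mul_lt : 3 * K < Fintype.card V
  /-- singletons are small -/
  one_le : 1 ≤ K
  /-- isoperimetry: small boundary forces a small or a co-small set -/
  iso : ∀ T : Finset V, (bd A T).card ≤ d → T.card ≤ K ∨ Fintype.card V ≤ T.card + K
  /-- connectedness: only the trivial sets have empty boundary -/
  conn : ∀ T : Finset V, bd A T = ∅ → T = ∅ ∨ T = univ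

variable {A : V → Finset (Fin m)} {c : V → ZMod 2} {K d : ℕ}

/-- Small sets of equations with the same boundary have the same charge. [folklore] -/
theorem IsoHyp.charge_eq (h : IsoHyp A K d) (c : V → ZMod 2) {T T' : Finset V} (hT : T.card ≤ K)
    (hT' : T'.card ≤ K) (hb : bd A T = bd A T') : charge c T = charge c T' := by
  have h0 : bd A (symmDiff T T') = ∅ := by
    rw [bd_symmDiff, hb, symmDiff_self, Finset.bot_eq_empty]
  rcases h.conn _ h0 with h1 | h1
  · rw [Finset.symmDiff_eq_empty] at h1
    rw [h1]
  · exfalso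
    have h2 : (symmDiff T T').card ≤ T.card + T'.card :=
      (card_le_card symmDiff_subset_union).trans (card_union_le _ _)
    rw [h1, card_univ] at h2
    have h3 := h.three_mul_lt
    omega

/-- The value of `e` on a determined set. [folklore] -/
theorem IsoHyp.e_eq (h : IsoHyp A K d) (c : V → ZMod 2) {T : Finset V} (hT : T.card ≤ K)
    {S : Finset (Fin m)} (hS : bd A T = S) : e A c K S = sgn (charge c T) := by
  unfold e
  by_cases hc : charge c T = 1
  · have hex : ∃ T : Finset V, T.card ≤ K ∧ bd A T = S ∧ charge c T = 1 := ⟨T, hT, hS, hc⟩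
    rw [if_pos hex, hc, sgn_one]
  · have hc0 : charge c T = 0 := (eq_zero_or_eq_one _).resolve_right hc
    have hnex : ¬ ∃ T : Finset V, T.card ≤ K ∧ bd A T = S ∧ charge c T = 1 :=
      fun ⟨T', hT', hS', hc'⟩ => hc ((h.charge_eq c hT hT' (hS.trans hS'.symm)).trans hc')
    have hdet : Det A K S := ⟨T, hT, hS⟩
    rw [if_neg hnex, if_pos hdet, hc0, sgn_zero]

/-- `e ∅ = 1`. [folklore] -/
theorem IsoHyp.e_empty (h : IsoHyp A K d) (c : V → ZMod 2) : e A c K ∅ = 1 := by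
  rw [h.e_eq c (T := ∅) (by simp) (bd_empty A), charge_empty, sgn_zero]

/-- `e (A v) = sgn (c v)`: the pseudo-character satisfies every single equation. [folklore] -/
theorem IsoHyp.e_apply_eq (h : IsoHyp A K d) (c : V → ZMod 2) (v : V) :
    e A c K (A v) = sgn (c v) := by
  rw [h.e_eq c (T := {v}) (by simpa using h.one_le) (bd_singleton A v), charge_singleton]

/-- **Closure and multiplicativity.** If `X`, `Y` are determined and `X ∆ Y` has at most `d`
variables then `X ∆ Y` is determined and `e (X ∆ Y) = e X · e Y`. [folklore] -/
theorem IsoHyp.e_mul (h : IsoHyp A K d) (c : V → ZMod 2) {X Y : Finset (Fin m)} (hX : Det A K X)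
    (hY : Det A K Y) (hd : (symmDiff X Y).card ≤ d) :
    Det A K (symmDiff X Y) ∧ e A c K (symmDiff X Y) = e A c K X * e A c K Y := by
  obtain ⟨T, hT, rfl⟩ := hX
  obtain ⟨T', hT', rfl⟩ := hY
  have hb : bd A (symmDiff T T') = symmDiff (bd A T) (bd A T') := bd_symmDiff A T T'
  have hsmall : (symmDiff T T').card ≤ K := by
    rcases h.iso (symmDiff T T') (hb ▸ hd) with h1 | h1
    · exact h1
    · exfalso
      have h2 : (symmDiff T T').card ≤ T.card + T'.card :=
      (card_le_card symmDiff_subset_union).trans (card_union_le _ _)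
      have h3 := h.three_mul_lt
      omega
  refine ⟨⟨_, hsmall, hb⟩, ?_⟩
  rw [h.e_eq c hT rfl, h.e_eq c hT' rfl, h.e_eq c hsmall hb, charge_symmDiff, sgn_add]

/-- `e = ±1` on determined sets. [folklore] -/
theorem IsoHyp.e_eq_one_or (h : IsoHyp A K d) (c : V → ZMod 2) {S : Finset (Fin m)}
    (hS : Det A K S) : e A c K S = 1 ∨ e A c K S = -1 := by
  obtain ⟨T, hT, hTS⟩ := hS
  rw [h.e_eq c hT hTS]
  exact sgn_eq_one_or _

/-- **Normalisation** `Ẽ 1 = 1`. [folklore] -/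
theorem IsoHyp.func_one (h : IsoHyp A K d) (c : V → ZMod 2) : func A c K (fun _ => 1) = 1 := by
  rw [one_eq_chi_empty, func_chi, h.e_empty]

/-- **Perfect completeness** `Ẽ [equation v is violated] = 0`. [folklore] -/
theorem IsoHyp.func_violInd (h : IsoHyp A K d) (c : V → ZMod 2) (v : V) :
    func A c K (fun y => if chi (A v) y = sgn (c v) then 0 else 1) = 0 := by
  have hf : (fun y => if chi (A v) y = sgn (c v) then (0 : ℝ) else 1) =
      (1 / 2 : ℝ) • (fun _ => (1 : ℝ)) - (sgn (c v) / 2) • chi (A v) := by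
    funext y
    simp only [Pi.sub_apply, Pi.smul_apply, smul_eq_mul]
    rw [violInd_eq]
    ring
  rw [hf, map_sub, map_smul, map_smul, h.func_one, func_chi, h.e_apply_eq, smul_eq_mul,
    smul_eq_mul]
  have h1 := sgn_mul_self (c v)
  linear_combination (-1 / 2 : ℝ) * h1

/-- The partial pseudo-density `∑_{S ⊆ U} e(S) χ_S(y)` is non-negative when `#U ≤ d`. [folklore] -/
theorem IsoHyp.sum_powerset_nonneg (h : IsoHyp A K d) (c : V → ZMod 2) {U : Finset (Fin m)}
    (hU : U.card ≤ d) (y : Fin m → ZMod 2) : 0 ≤ ∑ S ∈ U.powerset, e A c K S * chi S y := by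
  classical
  have hG : ∑ S ∈ U.powerset, e A c K S * chi S y =
      ∑ S ∈ U.powerset.filter (Det A K), e A c K S * chi S y := by
    rw [Finset.sum_filter]
    refine sum_congr rfl fun S _ => ?_
    split_ifs with hS
    · rfl
    · rw [e_eq_zero hS, zero_mul]
  rw [hG]
  have hsub : ∀ S ∈ U.powerset.filter (Det A K), ∀ S' ∈ U.powerset.filter (Det A K),
      symmDiff S S' ⊆ U ∧ Det A K S ∧ Det A K S' := by
    intro S hS S' hS'
    rw [mem_filter, mem_powerset] at hS hS'
    exact ⟨symmDiff_subset_union.trans (union_subset hS.1 hS'.1), hS.2, hS'.2⟩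
  refine sum_nonneg_of_symmDiff_closed _ _ ?_ ?_ ?_
  · intro S hS S' hS'
    obtain ⟨h1, h2, h3⟩ := hsub S hS S' hS'
    rw [mem_filter, mem_powerset]
    exact ⟨h1, (h.e_mul c h2 h3 ((card_le_card h1).trans hU)).1⟩
  · intro S hS S' hS'
    obtain ⟨h1, h2, h3⟩ := hsub S hS S' hS'
    rw [(h.e_mul c h2 h3 ((card_le_card h1).trans hU)).2, ← chi_mul_chi]
    ring
  · intro S hS
    rw [mem_filter] at hS
    rcases h.e_eq_one_or c hS.2 with h1 | h1 <;> rcases chi_eq_one_or S y with h2 | h2 <;>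
      norm_num [h1, h2]

/-- **Sherali–Adams positivity.** `Ẽ f ≥ 0` for every non-negative `f` depending on at most `d`
coordinates: `Ẽ f = 2^{-m} ∑_y f(y) ∑_{S ⊆ U} e(S) χ_S(y)`. [folklore] -/
theorem IsoHyp.func_nonneg_of_junta (h : IsoHyp A K d) (c : V → ZMod 2)
    {f : (Fin m → ZMod 2) → ℝ} {U : Finset (Fin m)} (hU : U.card ≤ d)
    (hf : ∀ x y : Fin m → ZMod 2, (∀ i ∈ U, x i = y i) → f x = f y) (hpos : ∀ x, 0 ≤ f x) :
    0 ≤ func A c K f := by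
  rw [func_apply]
  have hrestrict : ∑ S ∈ U.powerset, e A c K S * coeff f S = ∑ S, e A c K S * coeff f S := by
    apply sum_subset (subset_univ _)
    intro S _ hS
    rw [mem_powerset] at hS
    rw [coeff_eq_zero_of_not_subset hf hS, mul_zero]
  have hexch : ∑ S ∈ U.powerset, e A c K S * coeff f S =
      (∑ y, f y * ∑ S ∈ U.powerset, e A c K S * chi S y) / 2 ^ m := by
    simp only [coeff, mul_div_assoc', ← sum_div]
    congr 1
    simp_rw [mul_sum]
    rw [sum_comm]
    refine sum_congr rfl fun y _ => sum_congr rfl fun S _ => ?_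
    ring
  rw [← hrestrict, hexch]
  exact div_nonneg (sum_nonneg fun y _ => mul_nonneg (hpos y) (h.sum_powerset_nonneg c hU y))
    (by positivity)

/-- Registered sub-goal `stub_perfectCompleteness_functional` of stub `stub_perfectCompleteness`:
perfect completeness of Grigoriev's functional under the isoperimetric hypotheses. [folklore] -/
theorem stub_perfectCompleteness_functional : ∀ {m : ℕ} {V : Type} [Fintype V] [DecidableEq V]
    {A : V → Finset (Fin m)} {K d : ℕ}, IsoHyp A K d → ∀ (c : V → ZMod 2) (v : V),
    func A c K (fun y => if chi (A v) y = sgn (c v) then 0 else 1) = 0 :=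
  fun h c v => h.func_violInd c v

end

end Summit.PneNP.PneNP.Theorems.XorDoor.PC
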